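import Summits.NavierStokesRegularity.NavierStokesRegularity.Theses.HodographBetchov
import Summits.NavierStokesRegularity.NavierStokesRegularity.Theorems.HodographBetchovHodographConditioning
import Summits.NavierStokesRegularity.NavierStokesRegularity.Theorems.HodographBetchovClassBudgetsRegulariseAlgebra

/-!
# Support item `HodographBetchov.VelocityClassBetchov` (stmt-NavierStokesRegularity-15835) — PROVED

BETCHOV ON VELOCITY CLASSES (card P1(c) of route `HodographBetchov`): for `u ∈ C¹(ℝ³; ℝ³)`
divergence free, tending to `0` at infinity, with `∇u ∈ L³`, and every bounded Borel `g`,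
`∫ g(u) ⟪ω, ∇u ω⟫ dx = −4 ∫ g(u) det S dx`, `ω = curl u`, `S = ½ (∇u + ∇uᵀ)`; the case
`g ≡ 1` is Betchov's 1956 identity `∫ ω·Sω = −4 ∫ det S`.

Proof: Betchov's POINTWISE split `⟪ω, ∇u ω⟫ − 4 det ∇u = −4 det S` (tree:
`ClassBudgetsRegularise.inner_curl_sub_four_det`, valid for every velocity gradient — the
divergence-free hypothesis is not even needed) and the hodograph identity `∫ g(u) det ∇u = 0`
(`HodographConditioning.integral_comp_mul_det_eq_zero`, the support item `HodographConditioning`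
just proved), with `det ∇u ∈ L¹` because `|det ∇u| ≤ (3/2) ‖∇u‖³`.

References: R. Betchov, J. Fluid Mech. 1 (1956) 497–504, §3; E. Miller, Arch. Ration. Mech.
Anal. 235 (2020) = arXiv:1710.05569, §5.
-/

noncomputable section

open MeasureTheory Set Function Filter Topology InnerProductSpace Metric
open scoped RealInnerProductSpace ContDiff ENNReal NNReal

-- the summit and its single sub-problem share the name (CONVENTIONS §1), as in every Theorems file
set_option linter.dupNamespace false

namespace Summit.NavierStokesRegularity.NavierStokesRegularity.Theorems

open Literature.Analysis Literature.Analysis.FluidPDE Literature.Analysis.FunctionSpaces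

/-- **Support item `VelocityClassBetchov` of route `HodographBetchov`
(stmt-NavierStokesRegularity-15835), proved.** For `u ∈ C¹(ℝ³; ℝ³)` tending to `0` at infinity
with `∇u ∈ L³` (divergence free, though this is not used) and every bounded Borel `g`:
`∫ g(u) ⟪curl u, ∇u (curl u)⟫ = −4 ∫ g(u) det (½ (∇u + ∇u†))`. Betchov's pointwise split
`⟪ω, ∇u ω⟫ − 4 det ∇u = −4 det S` and the hodograph identity `∫ g(u) det ∇u = 0`.
[cite: Betchov1956, §3] -/
theorem velocityClassBetchov_proof :
    Summit.NavierStokesRegularity.NavierStokesRegularity.Theses.HodographBetchov.VelocityClassBetchov := by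
  unfold Summit.NavierStokesRegularity.NavierStokesRegularity.Theses.HodographBetchov.VelocityClassBetchov
  intro u hu h0 hL3 _hdiv g hg hgb
  obtain ⟨B, hB⟩ := hgb
  have hdu : ∀ x, DifferentiableAt ℝ u x := fun x => (hu.differentiable one_ne_zero) x
  have hcA : Continuous (fderiv ℝ u) := hu.continuous_fderiv one_ne_zero
  have hcdet : Continuous fun x => (fderiv ℝ u x).det := ContinuousLinearMap.continuous_det.comp hcA
  -- `det ∇u ∈ L¹`
  have hdetI : Integrable (fun x => (fderiv ℝ u x).det) := by
    refine Integrable.mono' (hL3.const_mul (3 / 2)) hcdet.aestronglyMeasurable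
      (Eventually.of_forall fun x => ?_)
    rw [Real.norm_eq_abs]
    calc |(fderiv ℝ u x).det| ≤ (1 / 2) * ‖fderiv ℝ u x‖ * frobeniusNormSq (fderiv ℝ u x) :=
          ClassBudgetsRegularise.abs_det_fderiv_le (hdu x)
      _ ≤ (1 / 2) * ‖fderiv ℝ u x‖ * (3 * ‖fderiv ℝ u x‖ ^ 2) := by
          gcongr; exact frobeniusNormSq_le_three_mul _
      _ = 3 / 2 * ‖fderiv ℝ u x‖ ^ 3 := by ring
  -- the hodograph identity
  have hhc : ∫ x, g (u x) * (fderiv ℝ u x).det = 0 :=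
    HodographConditioning.integral_comp_mul_det_eq_zero hu h0 hdetI hg hB
  -- integrability of `g(u) det ∇u` and `g(u) ⟪ω, ∇u ω⟫`
  have hgm : AEStronglyMeasurable (fun x => g (u x)) volume :=
    (hg.comp hu.continuous.measurable).aestronglyMeasurable
  have hgb' : ∀ᵐ x ∂volume, ‖g (u x)‖ ≤ B :=
    Eventually.of_forall fun x => by rw [Real.norm_eq_abs]; exact hB _
  have hI2 : Integrable (fun x => g (u x) * (fderiv ℝ u x).det) := hdetI.bdd_mul hgm hgb'
  have hccurl : Continuous (curl u) := continuous_curl hu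
  have hprodI : Integrable (fun x => ⟪curl u x, fderiv ℝ u x (curl u x)⟫) := by
    refine Integrable.mono' (hL3.const_mul (‖curlCLM‖ ^ 2))
      (hccurl.inner (hcA.clm_apply hccurl)).aestronglyMeasurable (Eventually.of_forall fun x => ?_)
    rw [Real.norm_eq_abs]
    have hc := norm_curl_le u x
    calc |⟪curl u x, fderiv ℝ u x (curl u x)⟫| ≤ ‖curl u x‖ * ‖fderiv ℝ u x (curl u x)‖ :=
          abs_real_inner_le_norm _ _
      _ ≤ ‖curl u x‖ * (‖fderiv ℝ u x‖ * ‖curl u x‖) := by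
          gcongr; exact (fderiv ℝ u x).le_opNorm _
      _ ≤ (‖curlCLM‖ * ‖fderiv ℝ u x‖) * (‖fderiv ℝ u x‖ * (‖curlCLM‖ * ‖fderiv ℝ u x‖)) := by
          gcongr
      _ = ‖curlCLM‖ ^ 2 * ‖fderiv ℝ u x‖ ^ 3 := by ring
  have hI1 : Integrable (fun x => g (u x) * ⟪curl u x, fderiv ℝ u x (curl u x)⟫) :=
    hprodI.bdd_mul hgm hgb'
  -- Betchov's pointwise split, integrated against `g(u)`
  have hpt : ∀ x, g (u x) * ⟪curl u x, fderiv ℝ u x (curl u x)⟫ - 4 * (g (u x) * (fderiv ℝ u x).det) =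
      -4 * (g (u x) * ((1 / 2 : ℝ) • (fderiv ℝ u x + ContinuousLinearMap.adjoint (fderiv ℝ u x))).det) := by
    intro x
    have h := ClassBudgetsRegularise.inner_curl_sub_four_det u x
    calc g (u x) * ⟪curl u x, fderiv ℝ u x (curl u x)⟫ - 4 * (g (u x) * (fderiv ℝ u x).det)
        = g (u x) * (⟪curl u x, fderiv ℝ u x (curl u x)⟫ - 4 * (fderiv ℝ u x).det) := by ring
      _ = g (u x) * (-4 * ((1 / 2 : ℝ) • (fderiv ℝ u x + ContinuousLinearMap.adjoint (fderiv ℝ u x))).det) := by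
          rw [h]
      _ = -4 * (g (u x) * ((1 / 2 : ℝ) • (fderiv ℝ u x + ContinuousLinearMap.adjoint (fderiv ℝ u x))).det) := by
          ring
  have hsub : (∫ x, g (u x) * ⟪curl u x, fderiv ℝ u x (curl u x)⟫) - 4 * (∫ x, g (u x) * (fderiv ℝ u x).det) =
      ∫ x, (g (u x) * ⟪curl u x, fderiv ℝ u x (curl u x)⟫ - 4 * (g (u x) * (fderiv ℝ u x).det)) := by
    rw [← integral_const_mul, ← integral_sub hI1 (hI2.const_mul 4)]
  rw [hhc, mul_zero, sub_zero] at hsub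
  rw [hsub]
  simp_rw [hpt]
  exact integral_const_mul _ _

end Summit.NavierStokesRegularity.NavierStokesRegularity.Theorems

end
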